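import Summits.QuantumFields.YangMills.Theorems.LuscherReductionTwistedTraceScalingAxisRotation
import Summits.QuantumFields.YangMills.Theorems.LuscherReductionTwistedTraceScalingAlmostCommutingSU2
import Summits.QuantumFields.YangMills.Theorems.LuscherReductionTwistedTraceScalingValleyGeomOfLinkProx
import HarnessLib

/-!
# `ValleyLinkProxAt` DISCHARGED: every small-action configuration is an `O_L(S^{1/4})` kinetic step off a gauge copy of a flat abelian background
# (lane A of S-BASE, crux `TwistedTraceScaling` stmt-QuantumFields-20203; design note `pub/ym-fleet/ym-luscher-20007-p1/COARSE-DESIGN.md` §16)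

The comb propagation assembled (layers 1–4: `…CombTransport`, `…CombPropagation`, `…CombWraps`, `…CombFlat`, `…AxisRotation`, `…AlmostCommutingSU2`):
* ★★ `exists_step_decomp` — EVERY `U : GaugeConfig 3 L SU(2)` is `U = W · (g·V_θ)` with `‖W_e − 1‖_F ≤ combRadius L S(U)` on every link, where
  `combRadius L S = (L−1)(6L−4)√(2S) + √(2·combC L·√(2S))`, `combC L = 1 + (L−1)(10L−6)` — the `S^{1/4}` law (the comb gauge is comb-flat up to `O(L²)√S`;
  the three wrap representatives almost commute up to `O(L²)√S`; an almost-commuting triple is `O(S^{1/4})`-close to a common-axis one; a common-axis triple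
  is simultaneously diagonal after ONE constant rotation; comb-flat with diagonal wraps IS a gauge copy of `abelianCfg`);
* ★★★ `valleyLinkProxAt_pow` — `ValleyLinkProxAt L (β^{−p}) (β^{−q})` for `0 < p`, `4p < q`: the GEOMETRY SUB-TARGET of the C3 skeleton is a theorem;
* ★★★ `coarseNoIntruderAt_of_bo_pow` — END TO END: COARSE-UPPER(L) from `ValleyBOAt L (β^{−p}) (β^{−q})` and the one-orbit INNER NO-INTRUDER alone, for
  `0 < p < 1/3`, `4p < q < 8/9` (exponents of record `(1/16, 0.85)` qualify).
HONEST FRAMING: fixed-lattice bookkeeping for a stub lane of a child of the CONDITIONAL reduction route (femto rung R2b1); `ValleyBOAt` (lane B + C3d) remains OPEN;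
not infinite volume, not a gap, not Clay.
-/

set_option autoImplicit false

noncomputable section

open Matrix Real Filter Topology
open scoped Matrix BigOperators
open Literature.MathematicalPhysics.QuantumFieldTheory
open Literature.MathematicalPhysics.QuantumLattice

namespace Summit.QuantumFields.YangMills.Theorems.FemtoTransferGap

open TT TwoLattice TwoLattice.Toron TwoLattice.Flat TwoLattice.Cov

variable {L : ℕ} [NeZero L]

/-! ## §1 Constants -/

omit [NeZero L] in
/-- The commutator constant `combC L = 1 + (L−1)(10L−6)`: all three wrap commutators are within `combC L · √(2S)` of `1`. [folklore] -/
def combC (L : ℕ) : ℝ := 1 + ((L : ℝ) - 1) * (10 * (L : ℝ) - 6)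

omit [NeZero L] in
/-- The comb radius `combRadius L S = (L−1)(6L−4)√(2S) + √(2·combC L·√(2S))` (`≍ S^{1/4}` as `S → 0`). [folklore] -/
def combRadius (L : ℕ) (S : ℝ) : ℝ :=
  ((L : ℝ) - 1) * ((6 * (L : ℝ) - 4) * Real.sqrt (2 * S)) + Real.sqrt (2 * combC L * Real.sqrt (2 * S))

/-- `1 ≤ combC L`. [folklore] -/
theorem one_le_combC : 1 ≤ combC L := by
  have hL : (1 : ℝ) ≤ L := by exact_mod_cast NeZero.one_le
  unfold combC
  nlinarith

omit [NeZero L] in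
/-- `combRadius` is monotone in `S ≥ 0` (for `L ≥ 1`). [folklore] -/
theorem combRadius_mono (hL : (1 : ℝ) ≤ L) {S S' : ℝ} (hSS' : S ≤ S') : combRadius L S ≤ combRadius L S' := by
  unfold combRadius
  have h1 : Real.sqrt (2 * S) ≤ Real.sqrt (2 * S') := Real.sqrt_le_sqrt (by linarith)
  have hC : 0 ≤ combC L := by unfold combC; nlinarith
  have h2 : Real.sqrt (2 * combC L * Real.sqrt (2 * S)) ≤ Real.sqrt (2 * combC L * Real.sqrt (2 * S')) :=
    Real.sqrt_le_sqrt (by nlinarith)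
  have hL0 : 0 ≤ (L : ℝ) - 1 := by linarith
  have hL6 : 0 ≤ 6 * (L : ℝ) - 4 := by linarith
  nlinarith [mul_le_mul_of_nonneg_left h1 hL6]

/-! ## §2 Elementary `fd` bookkeeping -/

omit [NeZero L] in
/-- `d(A·B⁻¹, 1) = d(A, B)`. [folklore] -/
theorem fd_mul_inv_one (A B : SU2) : fd (A * B⁻¹) 1 = fd A B := by
  rw [← fd_mul_right B (A * B⁻¹) 1, inv_mul_cancel_right, one_mul]

omit [NeZero L] in
/-- Conjugation invariance: `d(P·A·P⁻¹, 1) = d(A, 1)`. [folklore] -/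
theorem fd_conj_one (P A : SU2) : fd (P * A * P⁻¹) 1 = fd A 1 := by
  rw [← fd_mul_left P A 1, ← fd_mul_right P⁻¹ (P * A) (P * 1), mul_one, mul_inv_cancel]

omit [NeZero L] in
/-- From `d(W, 1) ≤ r`: every component of the vector part is at most `r`. [folklore] -/
theorem abs_vecPart_le_of_fd_le {W : SU2} {r : ℝ} (h : fd W 1 ≤ r) (c : Fin 3) : |vecPart W c| ≤ r := by
  have h0 : 0 ≤ fd W 1 := frobNorm_nonneg _
  have hsum := sum_vecPart_sq_le_frobNorm_sub_one_sq W
  rw [← fd_one] at hsum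
  have hc : vecPart W c ^ 2 ≤ ∑ a, vecPart W a ^ 2 :=
    Finset.single_le_sum (f := fun a => vecPart W a ^ 2) (fun a _ => sq_nonneg _) (Finset.mem_univ c)
  have h2 : vecPart W c ^ 2 ≤ r ^ 2 := by nlinarith [hc, hsum, h0]
  exact abs_le_of_sq_le_sq' h2 (h0.trans h) |> fun h' => abs_le.2 h'

omit [NeZero L] in
/-- From `d(W, 1) ≤ 2`: `W` lies in the upper hemisphere. [folklore] -/
theorem scalarPart_nonneg_of_fd_le {W : SU2} (h : fd W 1 ≤ 2) : 0 ≤ scalarPart W := by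
  rw [scalarPart_nonneg_iff, ← fd_one]
  have h0 : 0 ≤ fd W 1 := frobNorm_nonneg _
  nlinarith

omit [NeZero L] in
/-- A constant gauge transformation of a comb-flat configuration conjugates the wraps. [folklore] -/
theorem gaugeTransform_const_combFlat (R : SU2) (h : Fin 3 → SU2) :
    gaugeTransform (fun _ : Site 3 L => R) (combFlat h) = combFlat (fun k => R * h k * R⁻¹) := by
  funext e
  simp only [gaugeTransform, combFlat_apply]
  split_ifs
  · rfl
  · rw [mul_one, mul_inv_cancel]

/-! ## §3 The wrap representatives almost commute -/

/-- All three wrap commutators are within `combC L · √(2S)` of `1`, and so every pairwise cross product of the wraps' vector parts is at most `combC L·√(2S)/2`.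
[cite: Luscher1983, §2] -/
theorem cross_wrapReps_le (U : GaugeConfig 3 L SU2) (i j : Fin 3) :
    Real.sqrt ((vecPart (wrapReps U i) ⨯₃ vecPart (wrapReps U j)) ⬝ᵥ (vecPart (wrapReps U i) ⨯₃ vecPart (wrapReps U j))) ≤
      combC L * Real.sqrt (2 * wilsonAction su2Rep U) / 2 := by
  have hL : (1 : ℝ) ≤ L := by exact_mod_cast NeZero.one_le
  set s := Real.sqrt (2 * wilsonAction su2Rep U) with hs
  have hs0 : 0 ≤ s := Real.sqrt_nonneg _
  have hC1 : 1 ≤ combC L := one_le_combC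
  have hbound0 : 0 ≤ combC L * s / 2 := by positivity
  -- the three commutator bounds, in `wrapReps` language
  have hw0 : wrapReps U 0 = treeFix U (mk3 (-1) 0 0, 0) := rfl
  have hw1 : wrapReps U 1 = treeFix U (mk3 0 (-1) 0, 1) := rfl
  have hw2 : wrapReps U 2 = treeFix U (mk3 0 0 (-1), 2) := rfl
  have hL0 : 0 ≤ (L : ℝ) - 1 := by linarith
  have c01 : fd (wrapReps U 0 * wrapReps U 1 * (wrapReps U 0)⁻¹ * (wrapReps U 1)⁻¹) 1 ≤ combC L * s := by
    rw [hw0, hw1]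
    refine (fd_comm01_le U).trans ?_
    rw [← hs]; unfold combC; nlinarith [mul_nonneg hL0 hs0]
  have c12 : fd (wrapReps U 1 * wrapReps U 2 * (wrapReps U 1)⁻¹ * (wrapReps U 2)⁻¹) 1 ≤ combC L * s := by
    rw [hw1, hw2]
    refine (fd_comm12_le U).trans ?_
    rw [← hs]; unfold combC; nlinarith [mul_nonneg hL0 hs0]
  have c02 : fd (wrapReps U 0 * wrapReps U 2 * (wrapReps U 0)⁻¹ * (wrapReps U 2)⁻¹) 1 ≤ combC L * s := by
    rw [hw0, hw2]
    refine (fd_comm02_le U).trans ?_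
    rw [← hs]; unfold combC; nlinarith [mul_nonneg hL0 hs0]
  -- symmetry and the diagonal
  have hsymm : ∀ a b : Fin 3 → ℝ, (b ⨯₃ a) ⬝ᵥ (b ⨯₃ a) = (a ⨯₃ b) ⬝ᵥ (a ⨯₃ b) := fun a b => by
    rw [← cross_anticomm, neg_dotProduct_neg]
  have hdiag : ∀ a : Fin 3 → ℝ, Real.sqrt ((a ⨯₃ a) ⬝ᵥ (a ⨯₃ a)) ≤ combC L * s / 2 := fun a => by
    rw [cross_self, dotProduct_zero, Real.sqrt_zero]; exact hbound0
  have h01 := (cross_le_of_comm (wrapReps U 0) (wrapReps U 1)).trans (by linarith [c01] : _ ≤ combC L * s / 2)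
  have h12 := (cross_le_of_comm (wrapReps U 1) (wrapReps U 2)).trans (by linarith [c12] : _ ≤ combC L * s / 2)
  have h02 := (cross_le_of_comm (wrapReps U 0) (wrapReps U 2)).trans (by linarith [c02] : _ ≤ combC L * s / 2)
  fin_cases i <;> fin_cases j
  · exact hdiag _
  · exact h01
  · exact h02
  · rw [hsymm]; exact h01
  · exact hdiag _
  · exact h12
  · rw [hsymm]; exact h02
  · rw [hsymm]; exact h12
  · exact hdiag _

/-! ## §4 ★★ The structural decomposition `U = W·(g·V_θ)` with `‖W − 1‖ ≤ combRadius L S(U)` -/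

/-- ★★ **Every `SU(2)` lattice gauge field on the `L³` torus is a kinetic step of size `combRadius L S(U)` off a gauge copy of a flat abelian background.**
[cite: Luscher1983, §2] -/
theorem exists_step_decomp (U : GaugeConfig 3 L SU2) :
    ∃ (W : GaugeConfig 3 L SU2) (g : Site 3 L → SU2) (θ : Fin 3 → ℝ),
      U = W * gaugeTransform g (abelianCfg L θ) ∧ ∀ e, fd (W e) 1 ≤ combRadius L (wilsonAction su2Rep U) := by
  set S := wilsonAction su2Rep U with hSdef
  set s := Real.sqrt (2 * S) with hs
  set ε := combC L * s / 2 with hεdef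
  -- (1) almost-commuting wraps → common-axis wraps
  obtain ⟨n, h', haxis, hclose⟩ := exists_common_axis_triple_near (wrapReps U) (ε := ε) (cross_wrapReps_le U)
  -- (2) common axis → simultaneously diagonal
  obtain ⟨R, φ, hdiag⟩ := exists_conj_diagSU2_family' n h' haxis
  -- (3) comb-flat with diagonal wraps is a gauge copy of `abelianCfg`
  obtain ⟨g₀, hg₀⟩ := combFlat_diag_eq (L := L) φ
  set θ : Fin 3 → ℝ := fun k => φ k / L with hθ
  have hflat : combFlat (L := L) h' = gaugeTransform ((fun _ : Site 3 L => R) * g₀) (abelianCfg L θ) := by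
    have hh' : h' = fun k => R * diagSU2 (φ k) * R⁻¹ := funext hdiag
    rw [← gaugeTransform_gaugeTransform, ← hg₀, gaugeTransform_const_combFlat, hh']
  -- (4) the step in the comb gauge
  set V := treeFix U with hV
  set W₁ : GaugeConfig 3 L SU2 := fun e => V e * (combFlat h' e)⁻¹ with hW₁
  have hVW : V = W₁ * combFlat h' := by
    funext e; simp only [hW₁, Pi.mul_apply, inv_mul_cancel_right]
  have hW₁le : ∀ e, fd (W₁ e) 1 ≤ combRadius L S := fun e => by
    simp only [hW₁]
    rw [fd_mul_inv_one]
    refine (fd_triangle (V e) (combFlat (wrapReps U) e) (combFlat h' e)).trans ?_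
    have hA := fd_treeFix_combFlat_le U e
    have hB : fd (combFlat (wrapReps U) e) (combFlat h' e) ≤ Real.sqrt (2 * combC L * Real.sqrt (2 * S)) := by
      rw [combFlat_apply, combFlat_apply]
      split_ifs with hw
      · have hsq : fd (wrapReps U e.2) (h' e.2) ^ 2 ≤ 4 * ε := hclose e.2
        have h0 : 0 ≤ fd (wrapReps U e.2) (h' e.2) := frobNorm_nonneg _
        have h4 : 4 * ε = 2 * combC L * Real.sqrt (2 * S) := by rw [hεdef, hs]; ring
        rw [← h4, ← Real.sqrt_sq h0]
        exact Real.sqrt_le_sqrt hsq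
      · rw [fd_self]; exact Real.sqrt_nonneg _
    unfold combRadius
    rw [← hs] at hA hB ⊢
    linarith
  -- (5) undo the tree gauge
  set t := treeGauge U with ht
  have hU : U = gaugeTransform t⁻¹ V := by rw [hV, treeFix, ← ht, gaugeTransform_inv_gaugeTransform]
  refine ⟨fun e => t⁻¹ e.1 * W₁ e * (t⁻¹ e.1)⁻¹, t⁻¹ * ((fun _ : Site 3 L => R) * g₀), θ, ?_, fun e => ?_⟩
  · rw [hU, hVW, gaugeTransform_mul, hflat, gaugeTransform_gaugeTransform]
  · rw [fd_conj_one]; exact hW₁le e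

/-- **Corollary**: the step is componentwise small and in the upper hemisphere as soon as `combRadius L S(U) ≤ r ≤ 2`. [cite: Luscher1983, §2] -/
theorem exists_step_decomp_of_le (U : GaugeConfig 3 L SU2) {r : ℝ} (hr : combRadius L (wilsonAction su2Rep U) ≤ r) (hr2 : r ≤ 2) :
    ∃ (W : GaugeConfig 3 L SU2) (g : Site 3 L → SU2) (θ : Fin 3 → ℝ),
      U = W * gaugeTransform g (abelianCfg L θ) ∧ (∀ e, 0 ≤ scalarPart (W e)) ∧ ∀ (e : Edge 3 L) (c : Fin 3), |vecPart (W e) c| ≤ r := by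
  obtain ⟨W, g, θ, hU, hW⟩ := exists_step_decomp U
  exact ⟨W, g, θ, hU, fun e => scalarPart_nonneg_of_fd_le (((hW e).trans hr).trans hr2), fun e c => abs_vecPart_le_of_fd_le ((hW e).trans hr) c⟩

/-! ## §5 β-asymptotics: `combRadius L (2β^{−q}) ≤ ε·β^{−p}` eventually, for `4p < q` -/

omit [NeZero L] in
/-- Scale comparison: for `4p < q` and `b > 0`, eventually `4·(max β 1)^{−q} ≤ b⁴·(max β 1)^{−4p}`. [folklore] -/
theorem eventually_four_rpow_le {p q b : ℝ} (hpq : 4 * p < q) (hb : 0 < b) :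
    ∃ β0 : ℝ, ∀ β : ℝ, β0 ≤ β → 4 * (max β 1) ^ (-q) ≤ b ^ 4 * (max β 1) ^ (-(4 * p)) := by
  set σ := q - 4 * p with hσ
  have hσ0 : 0 < σ := by rw [hσ]; linarith
  set c : ℝ := 4 / b ^ 4 with hc
  have hc0 : 0 < c := by positivity
  refine ⟨max 1 (c ^ σ⁻¹), fun β hβ => ?_⟩
  have hβ1 : 1 ≤ β := (le_max_left _ _).trans hβ
  have hm : max β 1 = β := max_eq_left hβ1
  rw [hm]
  have hβ0 : 0 < β := by linarith
  -- `c ≤ β^σ`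
  have hcβ : c ≤ β ^ σ := by
    have h1 : c ^ σ⁻¹ ≤ β := (le_max_right _ _).trans hβ
    have h2 : (c ^ σ⁻¹) ^ σ ≤ β ^ σ := Real.rpow_le_rpow (Real.rpow_nonneg hc0.le _) h1 hσ0.le
    rwa [Real.rpow_inv_rpow hc0.le hσ0.ne'] at h2
  have hsplit : β ^ (-q) = β ^ (-(4 * p)) * β ^ (-σ) := by
    rw [← Real.rpow_add hβ0]; congr 1; rw [hσ]; ring
  rw [hsplit]
  have hinv : β ^ (-σ) ≤ c⁻¹ := by
    rw [Real.rpow_neg hβ0.le]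
    exact inv_anti₀ hc0 hcβ
  have hpos : 0 ≤ β ^ (-(4 * p)) := Real.rpow_nonneg hβ0.le _
  calc 4 * (β ^ (-(4 * p)) * β ^ (-σ)) ≤ 4 * (β ^ (-(4 * p)) * c⁻¹) := by
        have := mul_le_mul_of_nonneg_left hinv hpos; nlinarith
    _ = b ^ 4 * β ^ (-(4 * p)) := by rw [hc]; field_simp

/-- ★ **The comb radius at valley scale is `o(δ)`**: for `0 < p`, `4p < q` and every `a ∈ (0, 1]`, eventually in `β`, every `S ≤ 2·powScale q β` has
`combRadius L S ≤ a · powScale p β` (and `a·powScale p β ≤ 1`). [cite: Luscher1983, §2] -/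
theorem combRadius_le_eventually {p q a : ℝ} (hp0 : 0 < p) (hpq : 4 * p < q) (ha0 : 0 < a) (ha1 : a ≤ 1) :
    ∃ β0 : ℝ, ∀ β : ℝ, β0 ≤ β → ∀ S : ℝ, 0 ≤ S → S ≤ 2 * powScale q β → combRadius L S ≤ a * powScale p β := by
  have hL : (1 : ℝ) ≤ L := by exact_mod_cast NeZero.one_le
  -- the constant `K = (L−1)(6L−4) + √(2·combC L) ≥ 1`
  set K : ℝ := ((L : ℝ) - 1) * (6 * (L : ℝ) - 4) + Real.sqrt (2 * combC L) with hK
  have hC1 : 1 ≤ combC L := one_le_combC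
  have hsqC : 1 ≤ Real.sqrt (2 * combC L) := by
    rw [show (1 : ℝ) = Real.sqrt 1 from Real.sqrt_one.symm]
    exact Real.sqrt_le_sqrt (by linarith)
  have hD0 : 0 ≤ ((L : ℝ) - 1) * (6 * (L : ℝ) - 4) := mul_nonneg (by linarith) (by linarith)
  have hK1 : 1 ≤ K := by rw [hK]; linarith
  have hK0 : 0 < K := by linarith
  set b : ℝ := a / K with hb
  have hb0 : 0 < b := div_pos ha0 hK0
  have hb1 : b ≤ 1 := by rw [hb, div_le_one hK0]; exact ha1.trans hK1
  obtain ⟨β0, hβ0⟩ := eventually_four_rpow_le hpq hb0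
  refine ⟨β0, fun β hβ S hS0 hS => ?_⟩
  have hcmp := hβ0 β hβ
  set m := max β 1 with hm
  have hm1 : 1 ≤ m := le_max_right _ _
  have hm0 : 0 ≤ m := by linarith
  have hδ : powScale p β = m ^ (-p) := rfl
  have hη : powScale q β = m ^ (-q) := rfl
  set δ := powScale p β with hδdef
  have hδ0 : 0 < δ := powScale_pos p β
  have hδ1 : δ ≤ 1 := powScale_le_one hp0.le β
  have hδ4 : δ ^ 4 = m ^ (-(4 * p)) := by
    rw [hδ, ← Real.rpow_natCast, ← Real.rpow_mul hm0]; congr 1; push_cast; ring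
  -- `u = (2S)^{1/4}`
  set u := Real.sqrt (Real.sqrt (2 * S)) with hu
  have hu0 : 0 ≤ u := Real.sqrt_nonneg _
  have hu2 : u ^ 2 = Real.sqrt (2 * S) := Real.sq_sqrt (Real.sqrt_nonneg _)
  have hu4 : u ^ 4 = 2 * S := by
    rw [show u ^ 4 = (u ^ 2) ^ 2 by ring, hu2, Real.sq_sqrt (by linarith)]
  -- `u⁴ = 2S ≤ 4η = 4 m^{−q} ≤ b⁴ m^{−4p} = (bδ)⁴`, so `u ≤ bδ ≤ 1`
  have hu4le : u ^ 4 ≤ (b * δ) ^ 4 := by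
    rw [hu4, mul_pow, hδ4]
    have : 2 * S ≤ 4 * m ^ (-q) := by rw [← hη]; linarith
    exact this.trans hcmp
  have hubδ : u ≤ b * δ := (pow_le_pow_iff_left₀ hu0 (by positivity) (by norm_num : (4 : ℕ) ≠ 0)).1 hu4le
  have hu1 : u ≤ 1 := hubδ.trans (by nlinarith)
  -- `combRadius L S = D u² + √(2C)·u ≤ K u ≤ a δ`
  have hsq : Real.sqrt (2 * combC L * Real.sqrt (2 * S)) = Real.sqrt (2 * combC L) * u := by
    rw [← hu2, Real.sqrt_mul (by linarith : (0:ℝ) ≤ 2 * combC L), Real.sqrt_sq hu0]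
  have hrad : combRadius L S = ((L : ℝ) - 1) * (6 * (L : ℝ) - 4) * u ^ 2 + Real.sqrt (2 * combC L) * u := by
    unfold combRadius; rw [hsq, ← hu2]; ring
  rw [hrad]
  have hu2le : u ^ 2 ≤ u := by nlinarith
  calc ((L : ℝ) - 1) * (6 * (L : ℝ) - 4) * u ^ 2 + Real.sqrt (2 * combC L) * u
      ≤ ((L : ℝ) - 1) * (6 * (L : ℝ) - 4) * u + Real.sqrt (2 * combC L) * u := by nlinarith [mul_le_mul_of_nonneg_left hu2le hD0]
    _ = K * u := by rw [hK]; ring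
    _ ≤ K * (b * δ) := mul_le_mul_of_nonneg_left hubδ hK0.le
    _ = a * δ := by rw [hb]; field_simp

/-! ## §6 ★★★ `ValleyLinkProxAt` at power scales, and the end-to-end corollary -/

/-- ★★★ **LINK PROXIMITY DISCHARGED**: `ValleyLinkProxAt L (β^{−p}) (β^{−q})` for `0 < p` and `4p < q`. [cite: Luscher1983, §2] -/
theorem valleyLinkProxAt_pow {p q : ℝ} (hp0 : 0 < p) (hpq : 4 * p < q) : ValleyLinkProxAt L (powScale p) (powScale q) := by
  intro ε hε
  set a := min ε 1 with ha
  have ha0 : 0 < a := lt_min hε one_pos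
  have ha1 : a ≤ 1 := min_le_right _ _
  have haε : a ≤ ε := min_le_left _ _
  obtain ⟨β0, hβ0⟩ := combRadius_le_eventually (L := L) hp0 hpq ha0 ha1
  refine ⟨β0, fun β hβ U hU => ?_⟩
  rw [mem_valleySet_iff] at hU
  have hS0 : 0 ≤ wilsonAction su2Rep U := wilsonAction_su2_nonneg_lat U
  have hδ0 : 0 < powScale p β := powScale_pos p β
  have hδ1 : powScale p β ≤ 1 := powScale_le_one hp0.le β
  have hr : combRadius L (wilsonAction su2Rep U) ≤ a * powScale p β := hβ0 β hβ _ hS0 hU.1.le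
  have hr2 : a * powScale p β ≤ 2 := by nlinarith
  obtain ⟨W, g, θ, hUeq, hhemi, hvec⟩ := exists_step_decomp_of_le U hr hr2
  exact ⟨W, g, θ, hUeq, hhemi, fun e c => (hvec e c).trans (by nlinarith)⟩

/-- ★★★ **`ValleyGeomAt` at power scales** (the geometry sub-target of the C3 skeleton, `…ValleySkeleton`): for `0 < p`, `4p < q`. [cite: Luscher1983, §2] -/
theorem valleyGeomAt_pow {p q : ℝ} (hp0 : 0 < p) (hpq : 4 * p < q) : ValleyGeomAt L (powScale p) (powScale q) :=
  valleyGeomAt_of_linkProx (valleyLinkProxAt_pow hp0 hpq) (fun β => powScale_pos p β) (fun β => powScale_le_one hp0.le β)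

/-- ★★★ **END TO END**: COARSE-UPPER(L) — the no-intruder bound `levelValue k ≤ e^{−dΛ/L}·levelValue 0` throughout the femto window — from the Born–Oppenheimer
sub-target `ValleyBOAt L (β^{−p}) (β^{−q})` and the one-orbit INNER NO-INTRUDER alone, for `0 < p < 1/3`, `4p < q < 8/9` (e.g. `(p, q) = (1/16, 0.85)`).
[cite: Luscher1983, §3] [cite: LuscherMunster1984, §2] -/
theorem coarseNoIntruderAt_of_bo_pow {p q : ℝ} (hp0 : 0 < p) (hp : p < 1 / 3) (hpq : 4 * p < q) (hq : q < 8 / 9)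
    (hBO : ValleyBOAt L (powScale p) (powScale q)) (hI : InnerNoIntruderOneOrbitAt L (powScale p)) :
    ∀ k : ℕ, ∀ d : ℝ, d < levelGap k → ∃ lam0 : ℝ, 0 < lam0 ∧ ∀ lam : ℝ, 0 < lam → lam ≤ lam0 →
      ∀ β : ℝ, InFemtoWindow lam β L →
        levelValue su2Rep L β k ≤ Real.exp (-(d * luscherLambda β L) / L) * levelValue su2Rep L β 0 :=
  coarseNoIntruderAt_of_bo_linkProx_pow hp0 hp hq hBO (valleyLinkProxAt_pow hp0 hpq) hI

end Summit.QuantumFields.YangMills.Theorems.FemtoTransferGap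

end
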